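import Literature.Dynamics.NBody.AlbouyKaloshin2012RobertsSymmetricFinal
import Literature.Dynamics.NBody.AlbouyKaloshin2012GenericSymmetricFinal
import Mathlib.Algebra.Polynomial.Roots
import Mathlib.Data.Fintype.Pi

/-!
# Univariate eliminants certify finiteness of the complex slice systems

Topic `Literature/Dynamics/NBody`; `pub-smale6` cell, seat 1 gen 3.  The kernel theorems
`roberts4441_reflSymmCCs_finite_of_complex` and `reflSymmCCs_223_finite_of_complex` reduce finiteness of all
reflection-symmetric central configurations of the two certified sample points of Albouy–Kaloshin's exceptional
component to the finiteness of the complex zero sets `t12BranchSetC …`, `t1234BranchSetC …` of explicit polynomial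
systems.  This file records the TYPED INTERFACE through which an exact computer-algebra certificate enters: if for every
coordinate `i` some NONZERO univariate polynomial `f_i ∈ ℂ[X]` vanishes at the `i`-th coordinate of every solution
(a univariate ELIMINANT — e.g. an element of the ideal found in a lexicographic Gröbner basis, or read off a verified
rational univariate parametrization), then the solution set is finite (`finite_of_coordRoots`, elementary: it embeds in
the finite product of the root sets).  Consequences: `t12BranchSetC_finite_of_eliminants`,
`t1234BranchSetC_finite_of_eliminants`, and the capstones `roberts4441_reflSymmCCs_finite_of_eliminants`,
`reflSymmCCs_223_finite_of_eliminants`.  NO eliminant is exhibited here: the cell's computations (`certs/modgb/`) are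
Gröbner bases modulo primes — evidence that such eliminants exist (zero-dimensional of degrees 4932, 4932, 6864 resp.
5220, 5220, 4788, 4788, 7536 modulo two primes), not the eliminants themselves.  Elementary; [folklore].
-/

namespace Literature.Dynamics.NBody

open Polynomial

/-- If each coordinate of each point of `S` (read through an injective coordinate map `π`) is a root of a fixed nonzero
univariate polynomial, then `S` is finite. [folklore] -/
theorem finite_of_coordRoots {α ι : Type*} [Fintype ι] [DecidableEq ι] (S : Set α) (π : α → ι → ℂ)
    (hπ : Set.InjOn π S) (h : ∀ i, ∃ f : ℂ[X], f ≠ 0 ∧ ∀ x ∈ S, f.IsRoot (π x i)) : S.Finite := by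
  classical
  choose f hf0 hf using h
  apply Set.Finite.of_finite_image _ hπ
  refine (Finset.finite_toSet (Fintype.piFinset fun i => (f i).roots.toFinset)).subset ?_
  rintro _ ⟨x, hx, rfl⟩
  simp only [Finset.mem_coe, Fintype.mem_piFinset, Multiset.mem_toFinset]
  intro i
  exact (Polynomial.mem_roots (hf0 i)).2 (hf i x hx)

/-- The twelve coordinates of a complex `T12` point, in the order `s, t, y₃, y₄, y₅, u, p₃, p₄, p₅, d₃₄, d₃₅, d₄₅`. [folklore] -/
def T12PtC.coords (X : T12PtC) : Fin 12 → ℂ :=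
  ![X.s, X.t, X.y₃, X.y₄, X.y₅, X.u, X.p₃, X.p₄, X.p₅, X.d₃₄, X.d₃₅, X.d₄₅]

/-- [folklore] -/
theorem T12PtC.coords_injective : Function.Injective T12PtC.coords := by
  rintro ⟨s, t, y₃, y₄, y₅, u, p₃, p₄, p₅, d₃₄, d₃₅, d₄₅⟩ ⟨s', t', y₃', y₄', y₅', u', p₃', p₄', p₅', d₃₄', d₃₅', d₄₅'⟩ h
  have e := fun i => congrFun h i
  have h0 := e 0; have h1 := e 1; have h2 := e 2; have h3 := e 3; have h4 := e 4; have h5 := e 5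
  have h6 := e 6; have h7 := e 7; have h8 := e 8; have h9 := e 9; have h10 := e 10; have h11 := e 11
  simp [T12PtC.coords] at h0 h1 h2 h3 h4 h5 h6 h7 h8 h9 h10 h11
  subst h0 h1 h2 h3 h4 h5 h6 h7 h8 h9 h10 h11
  rfl

/-- Univariate eliminants in all twelve coordinates ⇒ the complex `T12` branch system has finitely many solutions. [folklore] -/
theorem t12BranchSetC_finite_of_eliminants {σ₁₂ σ₃₄ σ₃₅ σ₄₅ b c : ℂ}
    (h : ∀ i : Fin 12, ∃ f : ℂ[X], f ≠ 0 ∧ ∀ X ∈ t12BranchSetC σ₁₂ σ₃₄ σ₃₅ σ₄₅ b c, f.IsRoot (X.coords i)) :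
    (t12BranchSetC σ₁₂ σ₃₄ σ₃₅ σ₄₅ b c).Finite :=
  finite_of_coordRoots _ T12PtC.coords T12PtC.coords_injective.injOn h

/-- The eleven coordinates of a complex `T1234` point, in the order `a₁, t₁, a₃, t₃, t₅, u, v, p, r, e, f`. [folklore] -/
def T1234PtC.coords (X : T1234PtC) : Fin 11 → ℂ :=
  ![X.a₁, X.t₁, X.a₃, X.t₃, X.t₅, X.u, X.v, X.p, X.r, X.e, X.f]

/-- [folklore] -/
theorem T1234PtC.coords_injective : Function.Injective T1234PtC.coords := by
  rintro ⟨a₁, t₁, a₃, t₃, t₅, u, v, p, r, e, f⟩ ⟨a₁', t₁', a₃', t₃', t₅', u', v', p', r', e', f'⟩ h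
  have E := fun i => congrFun h i
  have h0 := E 0; have h1 := E 1; have h2 := E 2; have h3 := E 3; have h4 := E 4; have h5 := E 5
  have h6 := E 6; have h7 := E 7; have h8 := E 8; have h9 := E 9; have h10 := E 10
  simp [T1234PtC.coords] at h0 h1 h2 h3 h4 h5 h6 h7 h8 h9 h10
  subst h0 h1 h2 h3 h4 h5 h6 h7 h8 h9 h10
  rfl

/-- Univariate eliminants in all eleven coordinates ⇒ the complex `T1234` branch system has finitely many solutions. [folklore] -/
theorem t1234BranchSetC_finite_of_eliminants {σ₁₂ σ₃₄ b c : ℂ}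
    (h : ∀ i : Fin 11, ∃ f : ℂ[X], f ≠ 0 ∧ ∀ X ∈ t1234BranchSetC σ₁₂ σ₃₄ b c, f.IsRoot (X.coords i)) :
    (t1234BranchSetC σ₁₂ σ₃₄ b c).Finite :=
  finite_of_coordRoots _ T1234PtC.coords T1234PtC.coords_injective.injOn h

/-- CAPSTONE (Roberts' masses).  Univariate eliminants for the three slice systems `T12` on `(+,+,+,+)`, `T12` on
`(+,+,+,−)` and `T1234` on `(+,+)` at `(b, c) = (1, 1/4)` ⇒ the reflection-symmetric positive normalized central
configurations of the masses `(4,4,4,4,1)` form a finite set.  (The three systems are zero-dimensional of degrees 4932, 4932,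
6864 modulo the primes 1073741827 and 2147483647 — evidence, recorded in the cell, that the eliminants exist; none is
exhibited here.) [cite: AlbouyKaloshin2012, Remark 8 p. 583] -/
theorem roberts4441_reflSymmCCs_finite_of_eliminants
    (hA : ∀ i : Fin 12, ∃ f : ℂ[X], f ≠ 0 ∧ ∀ X ∈ t12BranchSetC 1 1 1 1 1 (1 / 4), f.IsRoot (X.coords i))
    (hB : ∀ i : Fin 12, ∃ f : ℂ[X], f ≠ 0 ∧ ∀ X ∈ t12BranchSetC 1 1 1 (-1) 1 (1 / 4), f.IsRoot (X.coords i))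
    (hC : ∀ i : Fin 11, ∃ f : ℂ[X], f ≠ 0 ∧ ∀ X ∈ t1234BranchSetC 1 1 1 (1 / 4), f.IsRoot (X.coords i)) :
    (reflSymmCCs ![4, 4, 4, 4, 1]).Finite :=
  roberts4441_reflSymmCCs_finite_of_complex (t12BranchSetC_finite_of_eliminants hA)
    (t12BranchSetC_finite_of_eliminants hB) (t1234BranchSetC_finite_of_eliminants hC)

/-- CAPSTONE (generic point `(1,1,2,2,3)` of the exceptional component).  Univariate eliminants for the five slice systems ⇒
the reflection-symmetric positive normalized central configurations of `e32Masses 2 3` form a finite set.  (The five systems are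
zero-dimensional of degrees 5220, 5220, 4788, 4788, 7536 modulo both primes — evidence only.) [cite: AlbouyKaloshin2012, Remark 8 p. 583] -/
theorem reflSymmCCs_223_finite_of_eliminants
    (hA : ∀ i : Fin 12, ∃ f : ℂ[X], f ≠ 0 ∧ ∀ X ∈ t12BranchSetC 1 1 1 1 2 3, f.IsRoot (X.coords i))
    (hB : ∀ i : Fin 12, ∃ f : ℂ[X], f ≠ 0 ∧ ∀ X ∈ t12BranchSetC 1 1 1 (-1) 2 3, f.IsRoot (X.coords i))
    (hA' : ∀ i : Fin 12, ∃ f : ℂ[X], f ≠ 0 ∧ ∀ X ∈ t12BranchSetC 1 1 1 1 (1 / 2) (3 / 2), f.IsRoot (X.coords i))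
    (hB' : ∀ i : Fin 12, ∃ f : ℂ[X], f ≠ 0 ∧ ∀ X ∈ t12BranchSetC 1 1 1 (-1) (1 / 2) (3 / 2), f.IsRoot (X.coords i))
    (hC : ∀ i : Fin 11, ∃ f : ℂ[X], f ≠ 0 ∧ ∀ X ∈ t1234BranchSetC 1 1 2 3, f.IsRoot (X.coords i)) :
    (reflSymmCCs (e32Masses 2 3)).Finite :=
  reflSymmCCs_223_finite_of_complex (t12BranchSetC_finite_of_eliminants hA) (t12BranchSetC_finite_of_eliminants hB)
    (t12BranchSetC_finite_of_eliminants hA') (t12BranchSetC_finite_of_eliminants hB')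
    (t1234BranchSetC_finite_of_eliminants hC)

end Literature.Dynamics.NBody
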